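import Summits.CriticalPhenomena.PercolationContinuityZ3.Theorems.PercAnnulusCrossingNoiseSeeds
import Summits.CriticalPhenomena.PercolationContinuityZ3.Theorems.PercAnnulusCrossingOSSSBoxCross
import HarnessLib

/-!
# RSW3 lane (lead, gen 20): NOISE SENSITIVITY OF CROSSINGS, VI — Kesten's box crossings `boxCross L i` (every `d`, `L`, `i`, `p`):
# squared pivotal probabilities, low-level spectrum and noise correlation against `4·S_{L_i+1}(p)/(L_i+1)`

builds on p205010 (kernel theorem, internal audit signed; external expert review pending) — NOT used in this file (every `p`, every `d`).

Cell `prim-rsw3` (LANE 3), lead seat, gen 20.  Support file (`--supports stmt-CriticalPhenomena-4575`); no definitions, no named facts,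
no sorries.  Setting of gen 19's `boxCross_variance_le` (`…OSSSBoxCross`): the block `{0..L} ⊆ Λ(N)` read on the box cube of `Λ(N)` (all pairs
of `Λ(N)` as coordinates, bias `p` on lattice edges, `0` on the other pairs — degenerate coordinates, handled by parts I–V), the block incidence
and the `L_i⁺ + 1` hyperplane seed sets `H_s = {v ∈ {0..L} : v_i = s}` written inline.  THE RANDOMIZED ALGORITHM: pick `s` uniformly in
`{0, …, L_i⁺}` and explore the clusters of `H_s`; it computes `𝟙{boxCross L i}` and reveals a pair `{a,b}` of the block with probability
`≤ (L_i⁺+1)⁻¹ Σ_s (θ_{|a_i−s|} + θ_{|b_i−s|}) ≤ 4·S_{L_i⁺+1}(p)/(L_i⁺+1)`, `S_m(p) = Σ_{j<m} π_p(j)` (gen 19: `seedProb_hyperplane_le`,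
`sum_range_natAbs_sub_le`).  Consequences (`P = P_p(boxCross L i)`, `ℓ = L_i⁺`):

* `sum_seedProb_hyperplanes_le` — the mixed revealment bound `≤ 4 S_{ℓ+1}(p)/(ℓ+1)`.
* **`boxCross_sum_pivotal_sq_le`** — THE SQUARED PIVOTAL PROBABILITIES: `(ℓ+1)·p(1−p)·Σ_{z ⊆ Λ(N)} P_p(z ∈ E(ℤ^d), z pivotal for boxCross L i)²
  ≤ 4·S_{ℓ+1}(p)·P` (compare gen 19's OSSS LOWER bound `(ℓ+1)·P(1−P) ≤ 4p(1−p)·S_{ℓ+1}(p)·Σ_z P_p(z pivotal)` on the ℓ¹-norm).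
* **`boxCross_level_weight_le`** — `(ℓ+1)·Σ_{|S|=k} 𝟙̂(S)² ≤ 4k·S_{ℓ+1}(p)·P` on the box cube (p-biased characters written out).
* **`boxCross_noise_le`** — THE NOISE CORRELATION, for `0 ≤ ε ≤ 1` and every `m`:
  `0 ≤ E_p[𝟙_{boxCross}(ω)·𝟙_{boxCross}(ω^ε)] − P² ≤ m²·(4S_{ℓ+1}(p)/(ℓ+1))·P + (1−ε)^{m+1}·P(1−P)`, the ε-noised configuration `ω^ε`
  resampling each pair of `Λ(N)` independently with probability `ε` (finite-sum form on the box cube; `E_p[𝟙(ω)𝟙(ω^ε)]` is the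
  `P_p ⊗ P_p ⊗ Ber(ε)^{⊗}`-probability that the block is crossed both before and after the noise).

References: O. Schramm, J. Steif, Ann. of Math. 171 (2010) Thm 1.8/Cor 1.9, §4; I. Benjamini, G. Kalai, O. Schramm, Publ. IHÉS 90 (1999)
Thm 1.3, §1; H. Duminil-Copin, A. Raoufi, V. Tassion, Ann. of Math. 189 (2019) §3; V. Dewan, S. Muirhead, PTRF (2022) Lemma 2.9;
H. Kesten, *Percolation theory for mathematicians* (1982) §3.3.
-/

noncomputable section

namespace Summit.CriticalPhenomena.PercolationContinuityZ3.Theorems.Crossing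

open MeasureTheory Finset Function
open Literature.Probability.Percolation Literature.Probability.LatticeModels
open Literature.Probability.ODonnellSaksSchrammServedio2005
open Literature.Probability.ODonnellSaksSchrammServedio2005.Strategy
open Literature.Probability.Percolation.GhostExploration Literature.Probability.Percolation.SeedExploration
open Literature.Probability.Percolation.OneArmOSSS Literature.Probability.Percolation.DCT16
open Summit.CriticalPhenomena.PercolationContinuityZ3.Theorems.SurfaceTension
open Summit.CriticalPhenomena.PercolationContinuityZ3.Theorems.CrossingRevealment
open Summit.CriticalPhenomena.PercolationContinuityZ3.Theorems.Crossing.Spectral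

variable {d : ℕ} (L : Site d) (i : Fin d) (N : ℕ)

/-! ## §1 The mixed revealment of the uniformly chosen hyperplane -/

/-- **MIXED REVEALMENT OF THE UNIFORM HYPERPLANE**: for a pair `e = {a,b}` of the block incidence,
`Σ_{s=0}^{ℓ} (ℓ+1)⁻¹·(P(a ↔ H_s) + P(b ↔ H_s)) ≤ 4·S_{ℓ+1}(p)/(ℓ+1)`, `ℓ = L_i⁺`.
[cite: SchrammSteif2010, §4 (revealment of the exploration from a uniformly chosen line)] [cite: DuminilCopinRaoufiTassion2019, §3 proof of Lemma 3.2 (Σ_k δ_e(T_k) ≤ 4 S_n)] -/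
theorem sum_seedProb_hyperplanes_le (p : unitInterval) (e : PairIdx d N) (a b : BoxV d N)
    (hab : (fun a b : BoxV d N => if a.1 ∈ Icc 0 L ∧ b.1 ∈ Icc 0 L then latEdge d N a b else none) a b = some e) :
    ∑ s : Fin ((L i).toNat + 1), (1 / (((L i).toNat + 1 : ℕ) : ℝ)) *
        (seedProb (fun a b : BoxV d N => if a.1 ∈ Icc 0 L ∧ b.1 ∈ Icc 0 L then latEdge d N a b else none) (boxBias d N p)
            {v : BoxV d N | v.1 ∈ Icc 0 L ∧ v.1 i = ((s : ℕ) : ℤ)} a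
          + seedProb (fun a b : BoxV d N => if a.1 ∈ Icc 0 L ∧ b.1 ∈ Icc 0 L then latEdge d N a b else none) (boxBias d N p)
            {v : BoxV d N | v.1 ∈ Icc 0 L ∧ v.1 i = ((s : ℕ) : ℤ)} b)
      ≤ 4 * (∑ j ∈ Finset.range ((L i).toNat + 1), oneArmProb d p j) / (((L i).toNat + 1 : ℕ) : ℝ) := by
  set ℓ : ℕ := (L i).toNat with hℓ
  set θ : ℕ → ℝ := fun j => (bondPercolation (zdGraph d) p).real (siteToBoundary d j) with hθ
  have hθ0 : ∀ j, 0 ≤ θ j := fun j => measureReal_nonneg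
  have hanti : Antitone θ := antitone_real_siteToBoundary (d := d) p
  obtain ⟨⟨haB, hbB⟩, _⟩ := (blockEdge_eq_some_iff L N).1 hab
  have hLi : 0 ≤ L i := by
    have h := (Finset.mem_Icc.1 haB).2 i
    have h' := (Finset.mem_Icc.1 haB).1 i
    simp only [Pi.zero_apply] at h'
    linarith
  have hℓ' : ((ℓ : ℕ) : ℤ) = L i := by rw [hℓ]; exact Int.toNat_of_nonneg hLi
  have ha0 : 0 ≤ a.1 i := by have := (Finset.mem_Icc.1 haB).1 i; simpa using this
  have haℓ : a.1 i ≤ ℓ := by rw [hℓ']; exact (Finset.mem_Icc.1 haB).2 i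
  have hb0 : 0 ≤ b.1 i := by have := (Finset.mem_Icc.1 hbB).1 i; simpa using this
  have hbℓ : b.1 i ≤ ℓ := by rw [hℓ']; exact (Finset.mem_Icc.1 hbB).2 i
  -- termwise bound by `θ_{|a_i−s|} + θ_{|b_i−s|}`
  have hterm : ∀ s : Fin (ℓ + 1),
      seedProb (fun a b : BoxV d N => if a.1 ∈ Icc 0 L ∧ b.1 ∈ Icc 0 L then latEdge d N a b else none) (boxBias d N p)
            {v : BoxV d N | v.1 ∈ Icc 0 L ∧ v.1 i = ((s : ℕ) : ℤ)} a
          + seedProb (fun a b : BoxV d N => if a.1 ∈ Icc 0 L ∧ b.1 ∈ Icc 0 L then latEdge d N a b else none) (boxBias d N p)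
            {v : BoxV d N | v.1 ∈ Icc 0 L ∧ v.1 i = ((s : ℕ) : ℤ)} b
        ≤ θ (a.1 i - ((s : ℕ) : ℤ)).natAbs + θ (b.1 i - ((s : ℕ) : ℤ)).natAbs :=
    fun s => add_le_add (seedProb_hyperplane_le L i N p _ a) (seedProb_hyperplane_le L i N p _ b)
  have hpos : (0 : ℝ) < ((ℓ + 1 : ℕ) : ℝ) := by positivity
  calc ∑ s : Fin (ℓ + 1), (1 / ((ℓ + 1 : ℕ) : ℝ)) * _
      ≤ ∑ s : Fin (ℓ + 1), (1 / ((ℓ + 1 : ℕ) : ℝ)) * (θ (a.1 i - ((s : ℕ) : ℤ)).natAbs + θ (b.1 i - ((s : ℕ) : ℤ)).natAbs) :=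
        Finset.sum_le_sum fun s _ => mul_le_mul_of_nonneg_left (hterm s) (by positivity)
    _ = (1 / ((ℓ + 1 : ℕ) : ℝ)) * ((∑ s ∈ Finset.range (ℓ + 1), θ (a.1 i - (s : ℤ)).natAbs)
          + ∑ s ∈ Finset.range (ℓ + 1), θ (b.1 i - (s : ℤ)).natAbs) := by
        rw [← Finset.mul_sum, ← Finset.sum_add_distrib, ← Fin.sum_univ_eq_sum_range (fun s => θ (a.1 i - (s : ℤ)).natAbs + θ (b.1 i - (s : ℤ)).natAbs)]
    _ ≤ (1 / ((ℓ + 1 : ℕ) : ℝ)) * (2 * (∑ j ∈ Finset.range (ℓ + 1), θ j) + 2 * ∑ j ∈ Finset.range (ℓ + 1), θ j) :=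
        mul_le_mul_of_nonneg_left (add_le_add (sum_range_natAbs_sub_le θ hanti hθ0 ha0 haℓ) (sum_range_natAbs_sub_le θ hanti hθ0 hb0 hbℓ))
          (by positivity)
    _ = 4 * (∑ j ∈ Finset.range (ℓ + 1), oneArmProb d p j) / ((ℓ + 1 : ℕ) : ℝ) := by
        simp only [hθ, oneArmProb]
        field_simp
        ring

/-! ## §2 Squared pivotal probabilities, spectrum and noise correlation of `boxCross L i` -/

/-- Squared pivotality bridge: on the box cube, `b_e(1−b_e)·pivCross(e)² = p(1−p)·P_p(e ∈ E(ℤ^d), e pivotal)²` (both sides vanish off the lattice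
edges). [cite: RussoZW1981, §4 Lemma 3 (4.2)] -/
theorem bias_mul_pivCross_sq_hyperplanes_eq (hLN : Finset.Icc (0 : Site d) L ⊆ box d N) (p : unitInterval) (e : PairIdx d N) :
    boxBias d N p e * (1 - boxBias d N p e) * (pivCross
        (fun a b : BoxV d N => if a.1 ∈ Icc 0 L ∧ b.1 ∈ Icc 0 L then latEdge d N a b else none) (boxBias d N p)
        {v : BoxV d N | v.1 ∈ Icc 0 L ∧ v.1 i = 0} {v : BoxV d N | v.1 ∈ Icc 0 L ∧ v.1 i = L i} e) ^ 2
      = (p : ℝ) * (1 - p) * ((bondPercolation (zdGraph d) p).real {ω | e.1 ∈ (zdGraph d).edgeSet ∧ IsPivotal (boxCross L i) e.1 ω}) ^ 2 := by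
  classical
  by_cases he : e.1 ∈ (zdGraph d).edgeSet
  · rw [real_pivotal_boxCross_eq_pivCross L i N hLN p e he]
    unfold boxBias; rw [if_pos he]
  · have h0 : (bondPercolation (zdGraph d) p).real {ω | e.1 ∈ (zdGraph d).edgeSet ∧ IsPivotal (boxCross L i) e.1 ω} = 0 := by
      have : {ω : BondConfig (Site d) | e.1 ∈ (zdGraph d).edgeSet ∧ IsPivotal (boxCross L i) e.1 ω} = ∅ := by
        ext ω; simp [he]
      rw [this, measureReal_empty]
    rw [h0]
    unfold boxBias; rw [if_neg he]; ring

section Consequences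

variable (hLN : Finset.Icc (0 : Site d) L ⊆ box d N) (p : unitInterval)

/-- The hyperplanes `H_s`, `0 ≤ s ≤ ℓ`, all separate the two faces (the hypothesis `hsep` of part V, from gen 19's `hyperplane_separates`).
[cite: DewanMuirhead2022, §2 proof of Lemma 2.9] -/
theorem hyperplanes_separate (s : Fin ((L i).toNat + 1)) (y : PairIdx d N → Bool) (a b : BoxV d N)
    (ha : a ∈ {v : BoxV d N | v.1 ∈ Icc 0 L ∧ v.1 i = 0}) (hb : b ∈ {v : BoxV d N | v.1 ∈ Icc 0 L ∧ v.1 i = L i})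
    (hab : YReach (fun a b : BoxV d N => if a.1 ∈ Icc 0 L ∧ b.1 ∈ Icc 0 L then latEdge d N a b else none) y a b) :
    ∃ u ∈ {v : BoxV d N | v.1 ∈ Icc 0 L ∧ v.1 i = ((s : ℕ) : ℤ)}, YReach
        (fun a b : BoxV d N => if a.1 ∈ Icc 0 L ∧ b.1 ∈ Icc 0 L then latEdge d N a b else none) y u a ∧ YReach
        (fun a b : BoxV d N => if a.1 ∈ Icc 0 L ∧ b.1 ∈ Icc 0 L then latEdge d N a b else none) y u b :=
  hyperplane_separates L i N (s := ((s : ℕ) : ℤ)) (by positivity) (by exact_mod_cast (by omega : (s : ℕ) ≤ (L i).toNat)) y a b ha hb hab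

include hLN in
/-- **THE SQUARED PIVOTAL PROBABILITIES OF A BOX CROSSING** (every `d`, `L`, `i`, `p`; `ℓ = L_i⁺`, `{0..L} ⊆ Λ(N)`):
`(ℓ+1)·p(1−p)·Σ_{z ⊆ Λ(N)} P_p(z ∈ E(ℤ^d), z pivotal for boxCross L i)² ≤ 4·S_{ℓ+1}(p)·P_p(boxCross L i)` — the ℓ²-norm of the influence vector
against the Cesàro one-arm sum (gen 19 bounded the ℓ¹-norm `E[N_piv]` from BELOW by the same currency).
[cite: SchrammSteif2010, Thm 1.8 (k = 1)] [cite: BenjaminiKalaiSchramm1999, Thm 1.3 (Σ_e I_e²)] [cite: DuminilCopinRaoufiTassion2019, §3 Lemma 3.2] -/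
theorem boxCross_sum_pivotal_sq_le :
    ((((L i).toNat + 1 : ℕ)) : ℝ) * (((p : ℝ) * (1 - p))
        * ∑ z ∈ (box d N).sym2, ((bondPercolation (zdGraph d) p).real {ω | z ∈ (zdGraph d).edgeSet ∧ IsPivotal (boxCross L i) z ω}) ^ 2)
      ≤ 4 * (∑ j ∈ Finset.range ((L i).toNat + 1), oneArmProb d p j) * boxCrossProb d p L i := by
  classical
  set ℓ : ℕ := (L i).toNat with hℓ
  have hpos : (0 : ℝ) < ((ℓ + 1 : ℕ) : ℝ) := by positivity
  have hS0 : 0 ≤ ∑ j ∈ Finset.range (ℓ + 1), oneArmProb d p j := Finset.sum_nonneg fun _ _ => measureReal_nonneg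
  have h := sum_bias_mul_pivCross_sq_le (edge := fun a b : BoxV d N => if a.1 ∈ Icc 0 L ∧ b.1 ∈ Icc 0 L then latEdge d N a b else none)
    (blockEdge_symm L N) (blockEdge_ends L N) (boxBias d N p) (boxBias_nonneg N p.2.1) (boxBias_le_one N p.2.2)
    (X := {v : BoxV d N | v.1 ∈ Icc 0 L ∧ v.1 i = 0}) (B := {v : BoxV d N | v.1 ∈ Icc 0 L ∧ v.1 i = L i})
    (fun s : Fin (ℓ + 1) => {v : BoxV d N | v.1 ∈ Icc 0 L ∧ v.1 i = ((s : ℕ) : ℤ)}) (hyperplanes_separate L i N)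
    (fun _ => 1 / ((ℓ + 1 : ℕ) : ℝ)) (fun _ => by positivity) (by rw [Finset.sum_const, Finset.card_univ, Fintype.card_fin, nsmul_eq_mul]; field_simp)
    (δ := 4 * (∑ j ∈ Finset.range (ℓ + 1), oneArmProb d p j) / ((ℓ + 1 : ℕ) : ℝ))
    (div_nonneg (mul_nonneg (by norm_num) (Finset.sum_nonneg fun _ _ => measureReal_nonneg)) (Nat.cast_nonneg _))
    (fun e a b hab => sum_seedProb_hyperplanes_le L i N p e a b hab)
  rw [sum_wt_gcross_hyperplanes_eq L i N hLN p] at h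
  simp only [bias_mul_pivCross_sq_hyperplanes_eq L i N hLN p] at h
  rw [← Finset.mul_sum, Finset.sum_coe_sort (box d N).sym2
    (fun z => ((bondPercolation (zdGraph d) p).real {ω | z ∈ (zdGraph d).edgeSet ∧ IsPivotal (boxCross L i) z ω}) ^ 2)] at h
  -- `h : p(1−p) Σ ≤ (4S/(ℓ+1)) P`; multiply by `ℓ + 1`
  have h' := mul_le_mul_of_nonneg_left h hpos.le
  calc (((ℓ + 1 : ℕ)) : ℝ) * (((p : ℝ) * (1 - p))
        * ∑ z ∈ (box d N).sym2, ((bondPercolation (zdGraph d) p).real {ω | z ∈ (zdGraph d).edgeSet ∧ IsPivotal (boxCross L i) z ω}) ^ 2)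
      ≤ ((ℓ + 1 : ℕ) : ℝ) * (4 * (∑ j ∈ Finset.range (ℓ + 1), oneArmProb d p j) / ((ℓ + 1 : ℕ) : ℝ) * boxCrossProb d p L i) := h'
    _ = 4 * (∑ j ∈ Finset.range (ℓ + 1), oneArmProb d p j) * boxCrossProb d p L i := by
        field_simp

include hLN in
/-- **THE LOW-LEVEL SPECTRUM OF A BOX CROSSING** on the box cube (every `d`, `L`, `i`, `p`, `k ≥ 1`; p-biased characters written out, bias
`b = boxBias`): `(ℓ+1)·Σ_{|S|=k} 𝟙̂_{boxCross}(S)² ≤ 4k·S_{ℓ+1}(p)·P_p(boxCross L i)` — the crossing carries almost no Fourier weight below level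
`≈ √((ℓ+1)/S_{ℓ+1})`. [cite: SchrammSteif2010, Thm 1.8] [cite: GarbanSteif2014, Ch. VIII §3 (spectrum of percolation crossings)] -/
theorem boxCross_level_weight_le {k : ℕ} (hk : 1 ≤ k) :
    ((((L i).toNat + 1 : ℕ)) : ℝ) * ∑ S ∈ (Finset.univ : Finset (PairIdx d N)).powersetCard k,
        (∑ x : PairIdx d N → Bool, wt (boxBias d N p) x * (gcross
            (fun a b : BoxV d N => if a.1 ∈ Icc 0 L ∧ b.1 ∈ Icc 0 L then latEdge d N a b else none)
            {v : BoxV d N | v.1 ∈ Icc 0 L ∧ v.1 i = 0} {v : BoxV d N | v.1 ∈ Icc 0 L ∧ v.1 i = L i} x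
          * ∏ e ∈ S, (((if x e then (1 : ℝ) else 0) - boxBias d N p e) / Real.sqrt (boxBias d N p e * (1 - boxBias d N p e))))) ^ 2
      ≤ 4 * k * (∑ j ∈ Finset.range ((L i).toNat + 1), oneArmProb d p j) * boxCrossProb d p L i := by
  classical
  set ℓ : ℕ := (L i).toNat with hℓ
  have hpos : (0 : ℝ) < ((ℓ + 1 : ℕ) : ℝ) := by positivity
  have h := level_weight_gcross_le (edge := fun a b : BoxV d N => if a.1 ∈ Icc 0 L ∧ b.1 ∈ Icc 0 L then latEdge d N a b else none)
    (blockEdge_symm L N) (blockEdge_ends L N) (boxBias d N p) (boxBias_nonneg N p.2.1) (boxBias_le_one N p.2.2)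
    (X := {v : BoxV d N | v.1 ∈ Icc 0 L ∧ v.1 i = 0}) (B := {v : BoxV d N | v.1 ∈ Icc 0 L ∧ v.1 i = L i})
    (fun s : Fin (ℓ + 1) => {v : BoxV d N | v.1 ∈ Icc 0 L ∧ v.1 i = ((s : ℕ) : ℤ)}) (hyperplanes_separate L i N)
    (fun _ => 1 / ((ℓ + 1 : ℕ) : ℝ)) (fun _ => by positivity) (by rw [Finset.sum_const, Finset.card_univ, Fintype.card_fin, nsmul_eq_mul]; field_simp)
    (δ := 4 * (∑ j ∈ Finset.range (ℓ + 1), oneArmProb d p j) / ((ℓ + 1 : ℕ) : ℝ))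
    (div_nonneg (mul_nonneg (by norm_num) (Finset.sum_nonneg fun _ _ => measureReal_nonneg)) (Nat.cast_nonneg _))
    (fun e a b hab => sum_seedProb_hyperplanes_le L i N p e a b hab) hk
  rw [sum_wt_gcross_hyperplanes_eq L i N hLN p] at h
  have h' := mul_le_mul_of_nonneg_left h hpos.le
  refine h'.trans (le_of_eq ?_)
  field_simp

include hLN in
/-- **THE NOISE CORRELATION OF A BOX CROSSING** (every `d`, `L`, `i`, `p`, `0 ≤ ε ≤ 1`, every `m`; `ℓ = L_i⁺`, `P = P_p(boxCross L i)`,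
`S = S_{ℓ+1}(p)`): with `ω ~ P_p` read on the box cube of `Λ(N) ⊇ {0..L}` and `ω^ε` its ε-noised copy (each pair independently resampled with
probability `ε`): **`0 ≤ E[𝟙_{boxCross}(ω)·𝟙_{boxCross}(ω^ε)] − P² ≤ m²·(4S/(ℓ+1))·P + (1−ε)^{m+1}·(P − P²)`**.
[cite: SchrammSteif2010, Thm 1.8, Cor 1.9 (noise sensitivity of crossings from the revealment)] [cite: BenjaminiKalaiSchramm1999, §1 (1.2), Thm 1.2]
[cite: GarbanSteif2014, Ch. VIII §3] -/
theorem boxCross_noise_le {ε : ℝ} (hε0 : 0 ≤ ε) (hε1 : ε ≤ 1) (m : ℕ) :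
    0 ≤ (∑ x : PairIdx d N → Bool, ∑ y : PairIdx d N → Bool, ∑ n : PairIdx d N → Bool,
          wt (boxBias d N p) x * wt (boxBias d N p) y * wt (fun _ => ε) n
          * (gcross (fun a b : BoxV d N => if a.1 ∈ Icc 0 L ∧ b.1 ∈ Icc 0 L then latEdge d N a b else none)
              {v : BoxV d N | v.1 ∈ Icc 0 L ∧ v.1 i = 0} {v : BoxV d N | v.1 ∈ Icc 0 L ∧ v.1 i = L i} x
            * gcross (fun a b : BoxV d N => if a.1 ∈ Icc 0 L ∧ b.1 ∈ Icc 0 L then latEdge d N a b else none)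
              {v : BoxV d N | v.1 ∈ Icc 0 L ∧ v.1 i = 0} {v : BoxV d N | v.1 ∈ Icc 0 L ∧ v.1 i = L i}
              (fun e => if n e = true then y e else x e)))
        - (boxCrossProb d p L i) ^ 2 ∧
      (∑ x : PairIdx d N → Bool, ∑ y : PairIdx d N → Bool, ∑ n : PairIdx d N → Bool,
          wt (boxBias d N p) x * wt (boxBias d N p) y * wt (fun _ => ε) n
          * (gcross (fun a b : BoxV d N => if a.1 ∈ Icc 0 L ∧ b.1 ∈ Icc 0 L then latEdge d N a b else none)
              {v : BoxV d N | v.1 ∈ Icc 0 L ∧ v.1 i = 0} {v : BoxV d N | v.1 ∈ Icc 0 L ∧ v.1 i = L i} x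
            * gcross (fun a b : BoxV d N => if a.1 ∈ Icc 0 L ∧ b.1 ∈ Icc 0 L then latEdge d N a b else none)
              {v : BoxV d N | v.1 ∈ Icc 0 L ∧ v.1 i = 0} {v : BoxV d N | v.1 ∈ Icc 0 L ∧ v.1 i = L i}
              (fun e => if n e = true then y e else x e)))
        - (boxCrossProb d p L i) ^ 2
        ≤ (m : ℝ) ^ 2 * (4 * (∑ j ∈ Finset.range ((L i).toNat + 1), oneArmProb d p j) / ((((L i).toNat + 1 : ℕ)) : ℝ))
            * boxCrossProb d p L i
          + (1 - ε) ^ (m + 1) * (boxCrossProb d p L i - (boxCrossProb d p L i) ^ 2) := by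
  classical
  set ℓ : ℕ := (L i).toNat with hℓ
  have h := noise_gcross_sub_sq_le (edge := fun a b : BoxV d N => if a.1 ∈ Icc 0 L ∧ b.1 ∈ Icc 0 L then latEdge d N a b else none)
    (blockEdge_symm L N) (blockEdge_ends L N) (boxBias d N p) (boxBias_nonneg N p.2.1) (boxBias_le_one N p.2.2)
    (X := {v : BoxV d N | v.1 ∈ Icc 0 L ∧ v.1 i = 0}) (B := {v : BoxV d N | v.1 ∈ Icc 0 L ∧ v.1 i = L i})
    (fun s : Fin (ℓ + 1) => {v : BoxV d N | v.1 ∈ Icc 0 L ∧ v.1 i = ((s : ℕ) : ℤ)}) (hyperplanes_separate L i N)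
    (fun _ => 1 / ((ℓ + 1 : ℕ) : ℝ)) (fun _ => by positivity) (by rw [Finset.sum_const, Finset.card_univ, Fintype.card_fin, nsmul_eq_mul]; field_simp)
    (δ := 4 * (∑ j ∈ Finset.range (ℓ + 1), oneArmProb d p j) / ((ℓ + 1 : ℕ) : ℝ))
    (div_nonneg (mul_nonneg (by norm_num) (Finset.sum_nonneg fun _ _ => measureReal_nonneg)) (Nat.cast_nonneg _))
    (fun e a b hab => sum_seedProb_hyperplanes_le L i N p e a b hab) hε0 hε1 m
  rw [sum_wt_gcross_hyperplanes_eq L i N hLN p] at h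
  exact h

end Consequences

end Summit.CriticalPhenomena.PercolationContinuityZ3.Theorems.Crossing

end
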